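import Literature.MathematicalPhysics.QuantumFieldTheory.Balaban1983to89.B13InverseLettersOnCoerciveBallLocated

/-!
# `Balaban1983to89.B13GreenChainOnCoerciveBallReg335Located` — T. Bałaban, *Propagators for lattice gauge theories in a background field*, Commun. Math. Phys. **99**
# (1985) 389–434 [Balaban1985BackgroundPropagators], (3.19)–(3.27) pp. 393–395, (3.35) p. 396, Thm 3.1 (3.42) p. 397, Thm 3.2 (3.48) p. 398, (3.46)–(3.47) p. 398, Thm 3.3
# p. 399, Thm 3.4 and (3.50) p. 400, (3.84)–(3.86) p. 407, Thm 3.10 (3.107)–(3.108) pp. 415–416, Thm 3.11 p. 416; [Balaban1984PropagatorsII] (2.19), p. 226, Lemma 2.1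
# (2.61) p. 234; [Balaban1988RG2Cluster] (2.5)–(2.7) pp. 12–13, p. 15: ★★★★ THE END-TO-END v4 G-CHAIN `G′ (w6) → X⁻¹ (w5) → R (w2) → G` ON THE REGULAR CLASS (3.35)
# AT THE READINGS OF RECORD — (§1) its thin-radius edition of record (this seat's `B13GreenStationCoerciveLocated` §2) with the N06-side form bound SUPPLIED from
# print's two statements by the lane's module 82, and (§2) RE-RUN THROUGH THE LANE's MODULE 84: G's letters on the WHOLE coercivity ball behind the R-station's radius.

THE DISPLAY.  This seat's `B13GreenStationCoerciveLocated` §2 reads, for every `U₀` in the class (3.35): the (3.35) data, `η`, `Rc`, the G′ rate window, dag-n10-w5's X⁻¹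
window, the R-loss `μ`, ONE dominating constant `B′` for the assembled Δ_a letters (`hBΔ : ∀ R, 0 < R → R ≤ Rc → N(R) ≤ B′`), the form bound `(w, Θ, m, hco)` for
`Δ_a(U₀)`, a Combes–Thomas window and a target rate ⟹ `∃ R₁, 0 < R₁ ∧ R₁ ≤ R₁⋆ ∧` G's letters on the THIN Neumann radius `R₁∕(4B′Θ(4∕m)c_V′² + 1)`.  §1 here supplies
`(w, Θ, m, hco) := (1, 1, B⁻¹, module 82 §2)` — displayed instead: Theorem 3.11's clause `hpd : PosDefTr 1 (Δ_a(U₀))` (row 17) and Theorem 3.3's (3.46)–(3.47) form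
bound `hGB : ⟨Φ, G(U₀)Φ⟩₁ ≤ B⟨Φ,Φ⟩₁` (the lane owner's «3-line sibling», INBOX l.37350).  §2 replaces the thin-radius junction by the lane's module 84 (through
`B13InverseLettersOnCoerciveBallLocated` §2): behind the hidden radius `R₁` the WHOLE ball family (every `R′ ≤ R₁` with positive margin `m′ = m − 2(B′c_V)R′∕R₁` and the
window at `m′`; letters `(R′, κ, 4∕m′)`), and its clean member at the half-margin radius `R′ = R₁·m∕(m + 4B′c_V)` (margin `≥ m∕2`, letters `(R′, κ, 8∕m)` under the
displayed window `16B′κc_V(½) ≤ m(ρ″−2μ)`) — with the flat `hco`, or with print's two statements (`m = B⁻¹`, constant `8B`).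

[folklore] positional applications of cited tree theorems + one `obtain` each + (§2's half-margin member) a dozen lines of real arithmetic (`field_simp`, `nlinarith`,
`rawEntryLetters_mono`); kernel-checked; THEOREMS ONLY (no `def`, no `structure`, no instance, no notation; `open scoped Matrix.Norms.L2Operator` = the record's norm);
NOTHING of NODE 00's ∕ pv27's ∕ the lane's ∕ dag-n10-w2's ∕ dag-n10-w5's ∕ dag-n10-w6's files is modified; nothing here is a claim about the Yang–Mills mass gap; no node is
discharged; count-neutral.

WHY THIS FILE (cell `pub-ymgap`, HUMAN RULING D-0062 ∕ D-0149, Track A node N10 = [B13]; WIDTH SEAT `pub-ymgap-dag-n10-w4` g6, CLAIM-2 (R455 (A)); lane owner dag-n10-c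
g16's RESIDUAL CENSUS v21 item 1 («With BOTH [Thm 3.11's clause and Thm 3.3's L² bound] at one background per pencil, 82 + (w4's p630543 §2 or 84 §2) close the G-station BY
NAME with located constants») and item 3 («located editions at the readings of record of 82 §3 ∕ 84 §2 (w4, first refusal)»).  WHICH reading ∕ coordinates the N10 term
of record uses is NODE 00's ∕ def-T's word — NOT claimed here; LOCATED INSTANCES.

WHAT THIS FILE PROVES (all `theorem`s; `c_V = (d+1)N²c₀(1,ρ″−2μ)^{d+1}`, `c_V(½) = (d+1)N²c₀(1,(ρ″−2μ)∕2)^{d+1}`, `c_V′ = (d+1)N²c₀(1,(κ−ρ_t)∕3)^{d+1}`).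
* §1 ★★★★ `exists_rawEntryLetters_toMatrix_GAY_recordV4_prodCfg_of_reg335_of_posDefTr_of_formBound_located` — the thin-radius chain of record with `hpd + hGB`:
  `∃ R₁, 0 < R₁ ∧ R₁ ≤ R₁⋆ ∧ RawEntryLetters (A′ ↦ toMatrix (G(e^{iηA′}U₀))) (bondReadingY ∘ fst) (R₁∕(4B′(4B)c_V′² + 1)) ρ_t (2(4B))`.
* §2 ★★★★ `exists_rawEntryLetters_toMatrix_GAY_recordV4_prodCfg_ballFamily_of_reg335_of_coercive_located` (the whole ball family behind `R₁`, flat `hco`) · ★★★★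
  `exists_rawEntryLetters_toMatrix_GAY_recordV4_prodCfg_halfMargin_of_reg335_of_coercive_located` (`R′ = R₁·m∕(m + 4B′c_V)`, constant `8∕m`) · ★★★★
  `exists_rawEntryLetters_toMatrix_GAY_recordV4_prodCfg_halfMargin_of_reg335_of_posDefTr_of_formBound_located` (the same with `hpd + hGB`, `m = B⁻¹`, constant `8B`).
HONEST FRAMING: located instances; finite-lattice constants, NOT optimised, NOT print's `O(1)`; print's multi-scale rate (3.42) is NOT claimed — the rates are whatever the
displayed windows allow; the analytic inputs — Theorems 3.1 ∕ 3.2 enter through dag-n10-w6's ∕ dag-n10-w5's ∕ dag-n10-w2's located stations (tree theorems on (3.35)), while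
Δ_a's coercivity `hco`, resp. Theorem 3.11's clause `hpd` and Theorem 3.3's (3.46)–(3.47) form bound `hGB` for `G(U₀)`, stay DISPLAYED (N06's, NOT in the tree on (3.35));
the balls are in the CHART around `U₀`; nothing of Bałaban's asserted; N06 ∕ N10 NOT discharged; K1⁹ stmt-QuantumFields-27364 OPEN, no registered stub proved; counts unmoved
(typed 28∕28 · discharged 5∕27); 0 `def`, 0 `sorry`, standard axioms; one finite 𝕋⁴ programme at fixed ε, Bałaban AS PRINTED — R4 closes the conditional finite-𝕋⁴ rung
`BalabanLadder.UV` only; the YM mass gap (Clay) is NOT proved by any of this; nothing continuum ∕ ℝ⁴ ∕ OS.  Filed `--kind proof --supports stmt-QuantumFields-27364`, Literature lane.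

References: T. Bałaban, CMP 99 (1985) 389–434 [Balaban1985BackgroundPropagators] (3.19)–(3.27) pp.393–395, (3.35) p.396, Thm 3.1 (3.42) p.397, Thm 3.2 (3.48) p.398,
(3.46)–(3.47) p.398, Thm 3.3 p.399, Thm 3.4 and (3.50) p.400, (3.84)–(3.86) p.407, Thm 3.10 (3.107)–(3.108) pp.415–416, Thm 3.11 p.416; CMP 96 (1984) 223–250
[Balaban1984PropagatorsII] (2.19), p.226, Lemma 2.1 (2.61) p.234; CMP 116 (1988) 1–22 [Balaban1988RG2Cluster] (2.5)–(2.7) pp.12–13, p.15; M. Aizenman, S. Warzel, *Random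
Operators* (AMS 2015) §10.3 [AizenmanWarzel2015].
-/

noncomputable section

namespace Literature.MathematicalPhysics.QuantumFieldTheory.Balaban1983to89.B13GreenChainOnCoerciveBallReg335Located

open Finset Module
open scoped Matrix Matrix.Norms.L2Operator
open Literature.MathematicalPhysics.QuantumFieldTheory.Balaban1983to89
open Literature.MathematicalPhysics.QuantumFieldTheory.Balaban1983to89.B9Thm37GlueTorus (tdist1)
open Literature.MathematicalPhysics.QuantumFieldTheory.Balaban1983to89.B5TorusCover (UT)
open Literature.MathematicalPhysics.QuantumFieldTheory.Balaban1983to89.B9Thm311ReadingCoords (trIP PosDefTr)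
open Literature.MathematicalPhysics.QuantumFieldTheory.Balaban1983to89.B13EntrywiseWalks (RawEntryLetters)
open Literature.MathematicalPhysics.QuantumFieldTheory.Balaban1983to89.B13EntryLetterAlgebra (rawEntryLetters_mono)
open Literature.MathematicalPhysics.QuantumFieldTheory.Balaban1983to89.B9Eq39Adjoint (prodCfg)
open Literature.MathematicalPhysics.QuantumFieldTheory.Balaban1983to89.B6GlobalChartV1 (PV)
open Literature.MathematicalPhysics.QuantumFieldTheory.Balaban1983to89.B6KLevelCensusIndexV1 (KIdx kGeo)
open Literature.MathematicalPhysics.QuantumFieldTheory.Balaban1983to89.B9BackgroundsKLevelV1 (bg9K)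
open Literature.MathematicalPhysics.QuantumFieldTheory.Balaban1983to89.Node00 (SiteY FBondY CfgY RY deltaAY GAY parBY parSymY GpY toKT)
open Literature.MathematicalPhysics.QuantumFieldTheory.Balaban1983to89.B13CoerciveOfInverseFormBound (trIP_deltaAY_parSymY_ge_of_posDefTr_of_GAY_formBound)
open Literature.MathematicalPhysics.QuantumFieldTheory.Balaban1983to89.B13GreenStationCoerciveLocated
  (exists_rawEntryLetters_toMatrix_GAY_recordV4_prodCfg_of_reg335_of_coercive_located)
open Literature.MathematicalPhysics.QuantumFieldTheory.Balaban1983to89.B13InverseLettersOnCoerciveBallLocated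
  (rawEntryLetters_toMatrix_deltaAY_parBY_prodCfg_of_pencil_located rawEntryLetters_toMatrix_GAY_parBY_prodCfg_ball_of_pencil_of_coercive_located)
open Literature.MathematicalPhysics.QuantumFieldTheory.Balaban1983to89.B13SiteReadingNumerals (fineReadingY)
open Literature.MathematicalPhysics.QuantumFieldTheory.Balaban1983to89.B13BlockBondReadingNumerals (bondReadingY)

variable {d ℓ : ℕ} {hd : 1 ≤ d + 1} {hL : Odd (ℓ + 1) ∧ 1 < ℓ + 1} {b₀ b₁ : ℝ}
variable (i : KIdx d ℓ hd hL b₀ b₁) {N : ℕ} [NeZero N] {G : Subgroup (Matrix (Fin N) (Fin N) ℂ)ˣ}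

/-! ## §1. ★★★★ The thin-radius chain of record with the form bound supplied from print's two statements (module 82 §2) -/

/-- ★★★★ **THE QUANTITATIVE v4 G-CHAIN ON (3.35) AT THE READINGS OF RECORD, N06-SIDE INPUT = PRINT's TWO STATEMENTS** — this seat's
`B13GreenStationCoerciveLocated.exists_rawEntryLetters_toMatrix_GAY_recordV4_prodCfg_of_reg335_of_coercive_located` (G′ (w6) → X⁻¹ (w5) → R (w2) → G, thin Neumann
radius) with its displayed form bound `(w, Θ, m, hco)` SUPPLIED as `(1, 1, B⁻¹, module 82 §2)` from Theorem 3.11's clause `PosDefTr 1 (Δ_a(U₀))` (row 17) and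
Theorem 3.3's (3.46)–(3.47) form bound `⟨Φ, G(U₀)Φ⟩₁ ≤ B⟨Φ,Φ⟩₁` (`0 < B`) — the lane owner's «3-line sibling» (INBOX l.37350).  DISPLAYED ONLY: the (3.35) data, `η`,
`0 < Rc`, the G′ rate window, dag-n10-w5's X⁻¹ window, the R-loss `μ`, ONE dominating constant `B′` (`hBΔ : ∀ R, 0 < R → R ≤ Rc → N(R) ≤ B′`), `hpd`, `0 < B`, `hGB`,
the Combes–Thomas window `0 ≤ κ ≤ (ρ″−2μ)∕4`, `8B′κ((d+1)N²c₀(1,(ρ″−2μ)∕2)^{d+1}) ≤ B⁻¹(ρ″−2μ)` and a target `0 ≤ ρ_t < κ`.  Conclusion: `∃ R₁, 0 < R₁ ∧ R₁ ≤ R₁⋆ ∧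
RawEntryLetters (A′ ↦ toMatrix (G(e^{iηA′}U₀))) (bondReadingY ∘ fst) (R₁∕(4B′(4B)((d+1)N²c₀(1,(κ−ρ_t)∕3)^{d+1})² + 1)) ρ_t (2(4B))`.
[cite: Balaban1985BackgroundPropagators, (3.19)–(3.27) pp.393–395, (3.35) p.396, Thm 3.1 (3.42) p.397, Thm 3.2 (3.48) p.398, (3.46)–(3.47) p.398, Thm 3.3 p.399, Thm 3.4 p.400, (3.84)–(3.86) p.407, Thm 3.10 (3.107)–(3.108) pp.415–416, Thm 3.11 p.416; Balaban1984PropagatorsII, (2.19) and p.226, Lemma 2.1 (2.61) p.234; Balaban1988RG2Cluster, (2.5)–(2.7) pp.12–13, p.15; AizenmanWarzel2015, §10.3] -/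
theorem exists_rawEntryLetters_toMatrix_GAY_recordV4_prodCfg_of_reg335_of_posDefTr_of_formBound_located
    (hG : G ≤ B7Prop2Explicit.unitaryUnits (Matrix (Fin N) (Fin N) ℂ))
    {U₀ : CfgY (Matrix (Fin N) (Fin N) ℂ) i} {c α₀ : ℝ} (hC0 : 0 ≤ c * (kGeo i).M * α₀) (hC1 : c * (kGeo i).M * α₀ * ((d : ℝ) + 1) ≤ 1 / 16)
    (hreg : (bg9K (Matrix (Fin N) (Fin N) ℂ) G i).Reg335 c α₀ U₀)
    (η : ℝ) {Rc : ℝ} (hRc : 0 < Rc) {ρ' : ℝ} (hρ'0 : 0 ≤ ρ')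
    (hρ' : ρ' < (1 / (4 * ((d : ℝ) + 2))) * ((((d : ℝ) + 1) * ((((ℓ + 1) ^ i.k : ℕ) : ℝ)))⁻¹))
    {μX : ℝ} (hμX : 0 < μX) (hμρ : μX < ρ')
    {κX : ℝ} (hκX : 0 ≤ κX) (hκ4X : κX ≤ (ρ' - μX) / 4)
    (hκmX : 8 * (Real.sqrt ((((ℓ : ℝ) + 1) ^ i.k) ^ (d + 1)) *
        (1 * (Fintype.card (Fin N × Fin N) : ℝ) *
            (1 * ((1 * Real.exp (|η| * Rc)) ^ ((d + 1) * ((ℓ + 1) ^ i.k - 1)) * 1 * (1 * Real.exp (|η| * Rc)) ^ ((d + 1) * ((ℓ + 1) ^ i.k - 1)))) *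
          ((((ℓ : ℝ) + 1) ^ i.k) ^ (d + 1) * (Fintype.card (Fin N × Fin N) : ℝ) *
            (1 * ((1 * Real.exp (|η| * Rc)) ^ ((d + 1) * ((ℓ + 1) ^ i.k - 1)) * 1 * (1 * Real.exp (|η| * Rc)) ^ ((d + 1) * ((ℓ + 1) ^ i.k - 1))))) *
          ((2 * (1 * 1 * (16 * ((((ℓ + 1) ^ i.k : ℕ) : ℝ)) ^ 2 * Real.sqrt N))) * (2 * (1 * 1 * (16 * ((((ℓ + 1) ^ i.k : ℕ) : ℝ)) ^ 2 * Real.sqrt N))) *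
            (((N * N : ℕ) : ℝ) * B6.c0 1 μX ^ (d + 1))) *
          Real.exp (2 * (ρ' - μX) * (((d : ℝ) + 1) * (((((ℓ + 1) ^ i.k : ℕ) : ℝ)) - 1))))) * κX *
        (((N * N : ℕ) : ℝ) * B6.c0 1 ((ρ' - μX) / 2) ^ (d + 1)) ≤
      ((4 * ((d : ℝ) + 1) + 1) ^ 2)⁻¹ * (ρ' - μX))
    {ρ'' : ℝ} (hρ''0 : 0 ≤ ρ'') (hρ'' : ρ'' < κX)
    {μ : ℝ} (hμ : 0 < μ) (h2μ : 2 * μ < ρ'')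
    {B' : ℝ}
    (hBΔ : ∀ R : ℝ, 0 < R → R ≤ Rc →
      1 * (((4 * ((d : ℝ) + 1) * |i.cf|) * ((1 * Real.exp (|η| * R)) * ((1 * Real.exp (|η| * R)) ^ 4 * ((4 * |i.cf|) * ((1 * Real.exp (|η| * R)) * 1 * (1 * Real.exp (|η| * R))))) * (1 * Real.exp (|η| * R))) + 1 / 2 * ((4 * ((d : ℝ) + 1)) * ((1 * Real.exp (|η| * R)) * (2 * (i.cf ^ 2 * (1 * Real.exp (|η| * R)) ^ 4) * (8 * ((1 * Real.exp (|η| * R)) * 1 * (1 * Real.exp (|η| * R))))) * (1 * Real.exp (|η| * R))))) + 2 * ((1 * Real.exp (|η| * R)) ^ ((d + 2) * ((ℓ + 1) ^ i.k - 1)) * ((|b₁| * i.cf ^ 2 * ((((ℓ + 1 : ℕ) : ℝ)) ^ i.k) ^ (d + 1)) * (1 * ((1 * Real.exp (|η| * R)) ^ ((d + 2) * ((ℓ + 1) ^ i.k - 1)) * 1 * (1 * Real.exp (|η| * R)) ^ ((d + 2) * ((ℓ + 1) ^ i.k - 1))))) * (1 * Real.exp (|η| * R)) ^ ((d + 2)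 * ((ℓ + 1) ^ i.k - 1)))) * Real.exp ((ρ'' - 2 * μ) * (2 * (((d : ℝ) + 2) * ((((ℓ + 1) ^ i.k : ℕ) : ℝ) - 1)))) +
          (2 * |i.cf|) * (Fintype.card (Fin N × Fin N) : ℝ) * (1 * ((1 * Real.exp (|η| * R)) * 1 * (1 * Real.exp (|η| * R)))) * ((2 * |i.cf|) * (Fintype.card (Fin N × Fin N) : ℝ) * (1 * ((1 * Real.exp (|η| * R)) * 1 * (1 * Real.exp (|η| * R))))) * (1 + 2 * (1 * 1 * (16 * ((((ℓ + 1) ^ i.k : ℕ) : ℝ)) ^ 2 * Real.sqrt N)) *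
            (1 * (Fintype.card (Fin N × Fin N) : ℝ) *
                (1 * ((1 * Real.exp (|η| * R)) ^ ((d + 1) * ((ℓ + 1) ^ i.k - 1)) * 1 * (1 * Real.exp (|η| * R)) ^ ((d + 1) * ((ℓ + 1) ^ i.k - 1)))) *
              (1 * (Fintype.card (Fin N × Fin N) : ℝ) *
                (1 * ((1 * Real.exp (|η| * R)) ^ ((d + 1) * ((ℓ + 1) ^ i.k - 1)) * 1 * (1 * Real.exp (|η| * R)) ^ ((d + 1) * ((ℓ + 1) ^ i.k - 1))))) *
              (2 * (1 * 1 * ((N : ℝ) ^ 3 * (Real.sqrt ((((ℓ : ℝ) + 1) ^ i.k) ^ (d + 1)) * (4 / ((4 * ((d : ℝ) + 1) + 1) ^ 2)⁻¹))))) *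
              Real.exp (2 * ρ'' * (((d : ℝ) + 1) * ((((ℓ + 1) ^ i.k : ℕ) : ℝ) - 1))) * (2 * (1 * 1 * (16 * ((((ℓ + 1) ^ i.k : ℕ) : ℝ)) ^ 2 * Real.sqrt N))) *
              (((N * N : ℕ) : ℝ) * B6.c0 1 μ ^ (d + 1))) *
            (((N * N : ℕ) : ℝ) * B6.c0 1 μ ^ (d + 1))) * Real.exp (2 * (ρ'' - 2 * μ) * 1) ≤ B')
    -- print's two statements at the centre: Theorem 3.11's clause (row 17) and Theorem 3.3's (3.46)–(3.47) for `G`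
    (hpd : PosDefTr (fun _ => (1 : ℝ)) (deltaAY i (parSymY i) (parBY i) (GpY i (parSymY i)) U₀))
    {B : ℝ} (hB : 0 < B)
    (hGB : ∀ Φ : FBondY i → Matrix (Fin N) (Fin N) ℂ,
      trIP (fun _ => (1 : ℝ)) Φ (GAY i (parSymY i) (parBY i) (GpY i (parSymY i)) U₀ Φ) ≤ B * trIP (fun _ => (1 : ℝ)) Φ Φ)
    {κ : ℝ} (hκ : 0 ≤ κ) (hκ4 : κ ≤ (ρ'' - 2 * μ) / 4)
    (hκm : 8 * B' * κ * ((((d + 1) * (N * N) : ℕ) : ℝ) * B6.c0 1 ((ρ'' - 2 * μ) / 2) ^ (d + 1)) ≤ B⁻¹ * (ρ'' - 2 * μ))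
    {ρt : ℝ} (hρt0 : 0 ≤ ρt) (hρt : ρt < κ) :
    ∃ R₁ : ℝ, 0 < R₁ ∧ R₁ ≤ Rc / (4 * ((1 * (((d : ℝ) + 1) * (1 * Real.exp (|η| * Rc) * (1 * Real.exp (|η| * Rc) * 1 * (1 * Real.exp (|η| * Rc)) + 1) * (1 * Real.exp (|η| * Rc)) +
            (1 * Real.exp (|η| * Rc) * 1 * (1 * Real.exp (|η| * Rc)) + 1)) + 1 * ((1 * Real.exp (|η| * Rc)) ^ (2 * (d + 1) * ((ℓ + 1) ^ i.k - 1)) * 1 * (1 * Real.exp (|η| * Rc)) ^ (2 * (d + 1) * ((ℓ + 1) ^ i.k - 1)))) *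
            Real.exp ((1 / (4 * ((d : ℝ) + 2)) * ((((d : ℝ) + 1) * ((((ℓ + 1) ^ i.k : ℕ) : ℝ)))⁻¹)) * (((d : ℝ) + 1) * ((((ℓ + 1) ^ i.k : ℕ) : ℝ))))) * (1 * 1 * (16 * ((((ℓ + 1) ^ i.k : ℕ) : ℝ)) ^ 2 * Real.sqrt N)) *
          (((N * N : ℕ) : ℝ) * B6.c0 1 (((1 / (4 * ((d : ℝ) + 2))) * ((((d : ℝ) + 1) * ((((ℓ + 1) ^ i.k : ℕ) : ℝ)))⁻¹) - ρ') / 3) ^ (d + 1)) *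
          (((N * N : ℕ) : ℝ) * B6.c0 1 (((1 / (4 * ((d : ℝ) + 2))) * ((((d : ℝ) + 1) * ((((ℓ + 1) ^ i.k : ℕ) : ℝ)))⁻¹) - ρ') / 3) ^ (d + 1))) + 1) ∧
  RawEntryLetters (fun a : Fin (d + 1) → Site (PV d ℓ i.m i.K hd hL) 0 → Matrix (Fin N) (Fin N) ℂ => LinearMap.toMatrix
          ((Pi.basis fun _ : FBondY i => Matrix.stdBasis ℂ (Fin N) (Fin N)).reindex (Equiv.sigmaEquivProd (FBondY i) (Fin N × Fin N))) ((Pi.basis fun _ : FBondY i => Matrix.stdBasis ℂ (Fin N) (Fin N)).reindex (Equiv.sigmaEquivProd (FBondY i) (Fin N × Fin N)))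
          (GAY i (parSymY i) (parBY i) (GpY i (parSymY i)) (prodCfg U₀ η a))) (fun p : FBondY i × (Fin N × Fin N) => bondReadingY i i.hN p.1)
      (R₁ / (4 * (B' * (4 * B) * ((((d + 1) * (N * N) : ℕ) : ℝ) * B6.c0 1 ((κ - ρt) / 3) ^ (d + 1)) * ((((d + 1) * (N * N) : ℕ) : ℝ) * B6.c0 1 ((κ - ρt) / 3) ^ (d + 1))) + 1)) ρt (2 * (4 * B)) := by
  obtain ⟨R₁, hR₁, hR₁le, h⟩ := exists_rawEntryLetters_toMatrix_GAY_recordV4_prodCfg_of_reg335_of_coercive_located i hG hC0 hC1 hreg η hRc hρ'0 hρ' hμX hμρ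
    hκX hκ4X hκmX hρ''0 hρ'' hμ h2μ hBΔ (fun _ => (1 : ℝ)) (fun _ => one_pos) zero_le_one (fun _ _ => by rw [one_mul]) (inv_pos.mpr hB)
    (trIP_deltaAY_parSymY_ge_of_posDefTr_of_GAY_formBound i hG hreg.1 hpd hB hGB) hκ hκ4 (by simpa only [one_mul] using hκm) hρt0 hρt
  exact ⟨R₁, hR₁, hR₁le, by simpa only [div_inv_eq_mul, one_mul] using h⟩

/-! ## §2. ★★★★ On the WHOLE coercivity ball: the (3.35) chain re-run through the lane's module 84 (radius `R′ ≤ R₁` itself, constant `4∕m′`) -/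

/-- ★★★★ **THE v4 G-CHAIN ON (3.35) AT THE READINGS OF RECORD, ON THE WHOLE COERCIVITY BALL — N06-SIDE INPUT = ONE FLAT FORM BOUND.**  For EVERY background
`U₀ ∈ (bg9K (M_N ℂ) G i).Reg335 c α₀` (`G ≤ U(N)`, `0 ≤ c·M·α₀`, `c·M·α₀·(d+1) ≤ 1∕16`): the R-station's output on (3.35) at the fine reading (dag-n10-w2 g4's
`B13OpsYPencilRProjSymLocated.…_of_reg335_located_of_xinvLocated`, fed by dag-n10-w5's located X⁻¹; radius `R₁ ≤ R₁⋆ ≤ Rc`, rate `ρ″ − 2μ`) feeds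
`B13InverseLettersOnCoerciveBallLocated.rawEntryLetters_toMatrix_GAY_parBY_prodCfg_ball_of_pencil_of_coercive_located` (Δ_a's letters assembled and dominated ONCE by `B′`,
then the lane's module 84 on the ball).  DISPLAYED ONLY: the (3.35) data, `η`, `0 < Rc`, the G′ rate window, the X⁻¹ window, the R-loss `0 < μ`, `2μ < ρ″`, `B′` with
`hBΔ : ∀ R, 0 < R → R ≤ Rc → N(R) ≤ B′`, and the centre's flat coercivity `m·⟨Ψ,Ψ⟩₁ ≤ ⟨Ψ, Δ_a(U₀)Ψ⟩₁` (Theorem 3.11 ∕ [4] p.226 quantitatively — N06's; by module 82 it is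
Theorem 3.11's clause + Theorem 3.3's (3.46)–(3.47)).  Conclusion — the WHOLE BALL FAMILY behind the hidden radius: `∃ R₁, 0 < R₁ ∧ R₁ ≤ R₁⋆ ∧ ∀ R′ κ, 0 ≤ R′ ≤ R₁ →
0 < m′ := m − 2(B′((d+1)N²c₀(1,ρ″−2μ)^{d+1}))R′∕R₁ → 0 ≤ κ ≤ (ρ″−2μ)∕4 → 8B′κ((d+1)N²c₀(1,(ρ″−2μ)∕2)^{d+1}) ≤ m′(ρ″−2μ) →
RawEntryLetters (A′ ↦ toMatrix (G(e^{iηA′}U₀))) (bondReadingY ∘ fst) R′ κ (4∕m′)`.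
[cite: Balaban1985BackgroundPropagators, (3.19)–(3.27) pp.393–395, (3.35) p.396, Thm 3.1 (3.42) p.397, Thm 3.2 (3.48) p.398, Thm 3.3 p.399, Thm 3.4 p.400, (3.84)–(3.86) p.407, Thm 3.10 (3.107)–(3.108) pp.415–416, Thm 3.11 p.416; Balaban1984PropagatorsII, (2.19) and p.226, Lemma 2.1 (2.61) p.234; Balaban1988RG2Cluster, (2.5)–(2.7) pp.12–13, p.15; AizenmanWarzel2015, §10.3] -/
theorem exists_rawEntryLetters_toMatrix_GAY_recordV4_prodCfg_ballFamily_of_reg335_of_coercive_located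
    (hG : G ≤ B7Prop2Explicit.unitaryUnits (Matrix (Fin N) (Fin N) ℂ))
    {U₀ : CfgY (Matrix (Fin N) (Fin N) ℂ) i} {c α₀ : ℝ} (hC0 : 0 ≤ c * (kGeo i).M * α₀) (hC1 : c * (kGeo i).M * α₀ * ((d : ℝ) + 1) ≤ 1 / 16)
    (hreg : (bg9K (Matrix (Fin N) (Fin N) ℂ) G i).Reg335 c α₀ U₀)
    (η : ℝ) {Rc : ℝ} (hRc : 0 < Rc) {ρ' : ℝ} (hρ'0 : 0 ≤ ρ')
    (hρ' : ρ' < (1 / (4 * ((d : ℝ) + 2))) * ((((d : ℝ) + 1) * ((((ℓ + 1) ^ i.k : ℕ) : ℝ)))⁻¹))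
    {μX : ℝ} (hμX : 0 < μX) (hμρ : μX < ρ')
    {κX : ℝ} (hκX : 0 ≤ κX) (hκ4X : κX ≤ (ρ' - μX) / 4)
    (hκmX : 8 * (Real.sqrt ((((ℓ : ℝ) + 1) ^ i.k) ^ (d + 1)) *
        (1 * (Fintype.card (Fin N × Fin N) : ℝ) *
            (1 * ((1 * Real.exp (|η| * Rc)) ^ ((d + 1) * ((ℓ + 1) ^ i.k - 1)) * 1 * (1 * Real.exp (|η| * Rc)) ^ ((d + 1) * ((ℓ + 1) ^ i.k - 1)))) *
          ((((ℓ : ℝ) + 1) ^ i.k) ^ (d + 1) * (Fintype.card (Fin N × Fin N) : ℝ) *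
            (1 * ((1 * Real.exp (|η| * Rc)) ^ ((d + 1) * ((ℓ + 1) ^ i.k - 1)) * 1 * (1 * Real.exp (|η| * Rc)) ^ ((d + 1) * ((ℓ + 1) ^ i.k - 1))))) *
          ((2 * (1 * 1 * (16 * ((((ℓ + 1) ^ i.k : ℕ) : ℝ)) ^ 2 * Real.sqrt N))) * (2 * (1 * 1 * (16 * ((((ℓ + 1) ^ i.k : ℕ) : ℝ)) ^ 2 * Real.sqrt N))) *
            (((N * N : ℕ) : ℝ) * B6.c0 1 μX ^ (d + 1))) *
          Real.exp (2 * (ρ' - μX) * (((d : ℝ) + 1) * (((((ℓ + 1) ^ i.k : ℕ) : ℝ)) - 1))))) * κX *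
        (((N * N : ℕ) : ℝ) * B6.c0 1 ((ρ' - μX) / 2) ^ (d + 1)) ≤
      ((4 * ((d : ℝ) + 1) + 1) ^ 2)⁻¹ * (ρ' - μX))
    {ρ'' : ℝ} (hρ''0 : 0 ≤ ρ'') (hρ'' : ρ'' < κX)
    {μ : ℝ} (hμ : 0 < μ) (h2μ : 2 * μ < ρ'')
    {B' : ℝ}
    (hBΔ : ∀ R : ℝ, 0 < R → R ≤ Rc →
      1 * (((4 * ((d : ℝ) + 1) * |i.cf|) * ((1 * Real.exp (|η| * R)) * ((1 * Real.exp (|η| * R)) ^ 4 * ((4 * |i.cf|) * ((1 * Real.exp (|η| * R)) * 1 * (1 * Real.exp (|η| * R))))) * (1 * Real.exp (|η| * R))) + 1 / 2 * ((4 * ((d : ℝ) + 1)) * ((1 * Real.exp (|η| * R)) * (2 * (i.cf ^ 2 * (1 * Real.exp (|η| * R)) ^ 4) * (8 * ((1 * Real.exp (|η| * R)) * 1 * (1 * Real.exp (|η| * R))))) * (1 * Real.exp (|η| * R))))) + 2 * ((1 * Real.exp (|η| * R)) ^ ((d + 2) * ((ℓ + 1) ^ i.k - 1)) * ((|b₁|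 * i.cf ^ 2 * ((((ℓ + 1 : ℕ) : ℝ)) ^ i.k) ^ (d + 1)) * (1 * ((1 * Real.exp (|η| * R)) ^ ((d + 2) * ((ℓ + 1) ^ i.k - 1)) * 1 * (1 * Real.exp (|η| * R)) ^ ((d + 2) * ((ℓ + 1) ^ i.k - 1))))) * (1 * Real.exp (|η| * R)) ^ ((d + 2) * ((ℓ + 1) ^ i.k - 1)))) * Real.exp ((ρ'' - 2 * μ) * (2 * (((d : ℝ) + 2) * ((((ℓ + 1) ^ i.k : ℕ) : ℝ) - 1)))) +
          (2 * |i.cf|) * (Fintype.card (Fin N × Fin N) : ℝ) * (1 * ((1 * Real.exp (|η| * R)) * 1 * (1 * Real.exp (|η| * R)))) * ((2 * |i.cf|) * (Fintype.card (Fin N × Fin N) : ℝ) * (1 * ((1 * Real.exp (|η| * R)) * 1 * (1 * Real.exp (|η| * R))))) * (1 + 2 * (1 * 1 * (16 * ((((ℓ + 1) ^ i.k : ℕ) : ℝ)) ^ 2 * Real.sqrt N)) *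
            (1 * (Fintype.card (Fin N × Fin N) : ℝ) *
                (1 * ((1 * Real.exp (|η| * R)) ^ ((d + 1) * ((ℓ + 1) ^ i.k - 1)) * 1 * (1 * Real.exp (|η| * R)) ^ ((d + 1) * ((ℓ + 1) ^ i.k - 1)))) *
              (1 * (Fintype.card (Fin N × Fin N) : ℝ) *
                (1 * ((1 * Real.exp (|η| * R)) ^ ((d + 1) * ((ℓ + 1) ^ i.k - 1)) * 1 * (1 * Real.exp (|η| * R)) ^ ((d + 1) * ((ℓ + 1) ^ i.k - 1))))) *
              (2 * (1 * 1 * ((N : ℝ) ^ 3 * (Real.sqrt ((((ℓ : ℝ) + 1) ^ i.k) ^ (d + 1)) * (4 / ((4 * ((d : ℝ) + 1) + 1) ^ 2)⁻¹))))) *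
              Real.exp (2 * ρ'' * (((d : ℝ) + 1) * ((((ℓ + 1) ^ i.k : ℕ) : ℝ) - 1))) * (2 * (1 * 1 * (16 * ((((ℓ + 1) ^ i.k : ℕ) : ℝ)) ^ 2 * Real.sqrt N))) *
              (((N * N : ℕ) : ℝ) * B6.c0 1 μ ^ (d + 1))) *
            (((N * N : ℕ) : ℝ) * B6.c0 1 μ ^ (d + 1))) * Real.exp (2 * (ρ'' - 2 * μ) * 1) ≤ B')
    {m : ℝ}
    (hco : ∀ Ψ : FBondY i → Matrix (Fin N) (Fin N) ℂ,
      m * trIP (fun _ => (1 : ℝ)) Ψ Ψ ≤ trIP (fun _ => (1 : ℝ)) Ψ (deltaAY i (parSymY i) (parBY i) (GpY i (parSymY i)) U₀ Ψ)) :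
    ∃ R₁ : ℝ, 0 < R₁ ∧ R₁ ≤ Rc / (4 * ((1 * (((d : ℝ) + 1) * (1 * Real.exp (|η| * Rc) * (1 * Real.exp (|η| * Rc) * 1 * (1 * Real.exp (|η| * Rc)) + 1) * (1 * Real.exp (|η| * Rc)) +
            (1 * Real.exp (|η| * Rc) * 1 * (1 * Real.exp (|η| * Rc)) + 1)) + 1 * ((1 * Real.exp (|η| * Rc)) ^ (2 * (d + 1) * ((ℓ + 1) ^ i.k - 1)) * 1 * (1 * Real.exp (|η| * Rc)) ^ (2 * (d + 1) * ((ℓ + 1) ^ i.k - 1)))) *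
            Real.exp ((1 / (4 * ((d : ℝ) + 2)) * ((((d : ℝ) + 1) * ((((ℓ + 1) ^ i.k : ℕ) : ℝ)))⁻¹)) * (((d : ℝ) + 1) * ((((ℓ + 1) ^ i.k : ℕ) : ℝ))))) * (1 * 1 * (16 * ((((ℓ + 1) ^ i.k : ℕ) : ℝ)) ^ 2 * Real.sqrt N)) *
          (((N * N : ℕ) : ℝ) * B6.c0 1 (((1 / (4 * ((d : ℝ) + 2))) * ((((d : ℝ) + 1) * ((((ℓ + 1) ^ i.k : ℕ) : ℝ)))⁻¹) - ρ') / 3) ^ (d + 1)) *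
          (((N * N : ℕ) : ℝ) * B6.c0 1 (((1 / (4 * ((d : ℝ) + 2))) * ((((d : ℝ) + 1) * ((((ℓ + 1) ^ i.k : ℕ) : ℝ)))⁻¹) - ρ') / 3) ^ (d + 1))) + 1) ∧
  ∀ ⦃R' κ : ℝ⦄, 0 ≤ R' → R' ≤ R₁ → 0 < m - 2 * (B' * ((((d + 1) * (N * N) : ℕ) : ℝ) * B6.c0 1 (ρ'' - 2 * μ) ^ (d + 1))) * R' / R₁ → 0 ≤ κ → κ ≤ (ρ'' - 2 * μ) / 4 →
    8 * B' * κ * ((((d + 1) * (N * N) : ℕ) : ℝ) * B6.c0 1 ((ρ'' - 2 * μ) / 2) ^ (d + 1)) ≤ (m - 2 * (B' * ((((d + 1) * (N * N) : ℕ) : ℝ) * B6.c0 1 (ρ'' - 2 * μ) ^ (d + 1))) * R' / R₁) * (ρ'' - 2 * μ) →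
  RawEntryLetters (fun a : Fin (d + 1) → Site (PV d ℓ i.m i.K hd hL) 0 → Matrix (Fin N) (Fin N) ℂ => LinearMap.toMatrix
          ((Pi.basis fun _ : FBondY i => Matrix.stdBasis ℂ (Fin N) (Fin N)).reindex (Equiv.sigmaEquivProd (FBondY i) (Fin N × Fin N))) ((Pi.basis fun _ : FBondY i => Matrix.stdBasis ℂ (Fin N) (Fin N)).reindex (Equiv.sigmaEquivProd (FBondY i) (Fin N × Fin N)))
          (GAY i (parSymY i) (parBY i) (GpY i (parSymY i)) (prodCfg U₀ η a))) (fun p : FBondY i × (Fin N × Fin N) => bondReadingY i i.hN p.1) R'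
      κ (4 / (m - 2 * (B' * ((((d + 1) * (N * N) : ℕ) : ℝ) * B6.c0 1 (ρ'' - 2 * μ) ^ (d + 1))) * R' / R₁)) := by
  -- R along the pencil on (3.35) at the fine reading, `hXi` discharged (dag-n10-w2 g4 ∘ dag-n10-w5), at some radius `0 < R₁ ≤ R₁⋆`
  obtain ⟨R₁, hR₁, hR₁le, hR⟩ :=
    B13OpsYPencilRProjSymLocated.rawEntryLetters_toMatrix_RY_parSymY_prodCfg_of_reg335_located_of_xinvLocated i hG hC0 hC1 hreg η hRc hρ'0 hρ' hμX hμρ hκX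
      hκ4X hκmX hρ''0 hρ'' hμ h2μ.le
  -- `R₁⋆ ≤ Rc`: the thin radius divides `Rc` by `4T + 1 ≥ 1`
  have hT : 0 ≤ ((1 * (((d : ℝ) + 1) *
          (1 * Real.exp (|η| * Rc) * (1 * Real.exp (|η| * Rc) * 1 * (1 * Real.exp (|η| * Rc)) + 1) * (1 * Real.exp (|η| * Rc)) +
            (1 * Real.exp (|η| * Rc) * 1 * (1 * Real.exp (|η| * Rc)) + 1)) +
          1 * ((1 * Real.exp (|η| * Rc)) ^ (2 * (d + 1) * ((ℓ + 1) ^ i.k - 1)) * 1 * (1 * Real.exp (|η| * Rc)) ^ (2 * (d + 1) * ((ℓ + 1) ^ i.k - 1)))) *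
            Real.exp ((1 / (4 * ((d : ℝ) + 2)) * ((((d : ℝ) + 1) * ((((ℓ + 1) ^ i.k : ℕ) : ℝ)))⁻¹)) * (((d : ℝ) + 1) * ((((ℓ + 1) ^ i.k : ℕ) : ℝ))))) *
          (1 * 1 * (16 * ((((ℓ + 1) ^ i.k : ℕ) : ℝ)) ^ 2 * Real.sqrt N)) *
          (((N * N : ℕ) : ℝ) * B6.c0 1 (((1 / (4 * ((d : ℝ) + 2))) * ((((d : ℝ) + 1) * ((((ℓ + 1) ^ i.k : ℕ) : ℝ)))⁻¹) - ρ') / 3) ^ (d + 1)) *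
          (((N * N : ℕ) : ℝ) * B6.c0 1 (((1 / (4 * ((d : ℝ) + 2))) * ((((d : ℝ) + 1) * ((((ℓ + 1) ^ i.k : ℕ) : ℝ)))⁻¹) - ρ') / 3) ^ (d + 1))) :=
    mul_nonneg (mul_nonneg (mul_nonneg
      (mul_nonneg (mul_nonneg zero_le_one (add_nonneg (by positivity) (mul_nonneg zero_le_one (by positivity)))) (Real.exp_pos _).le)
      (by positivity)) (mul_nonneg (Nat.cast_nonneg _) (pow_nonneg (B6RandomWalk.c0_nonneg 1 _) _)))
      (mul_nonneg (Nat.cast_nonneg _) (pow_nonneg (B6RandomWalk.c0_nonneg 1 _) _))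
  have hR₁Rc : R₁ ≤ Rc := hR₁le.trans (div_le_self hRc.le (by linarith))
  have hρR : 0 < ρ'' - 2 * μ := by linarith
  exact ⟨R₁, hR₁, hR₁le, fun R' κ hR'0 hR'R hmarg hκ hκ4 hκm =>
    rawEntryLetters_toMatrix_GAY_parBY_prodCfg_ball_of_pencil_of_coercive_located i (parSymY i) (GpY i (parSymY i)) hG hreg.1 i.hN η hR₁.le hρR hR
      (hBΔ R₁ hR₁ hR₁Rc) hco hR'0 hR'R hmarg hκ hκ4 hκm⟩

/-- ★★★★ **… AT THE HALF-MARGIN RADIUS `R′ = R₁·m∕(m + 4B′c_V)` — ONE CLEAN MEMBER OF THE BALL FAMILY** (`c_V = (d+1)N²c₀(1,ρ″−2μ)^{d+1}`): there the margin is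
`m′ = m(m + 2B′c_V)∕(m + 4B′c_V) ≥ m∕2`, so with the displayed window `0 ≤ κ ≤ (ρ″−2μ)∕4`, `16B′κ((d+1)N²c₀(1,(ρ″−2μ)∕2)^{d+1}) ≤ m(ρ″−2μ)` (and `0 < m`):
`∃ R₁, 0 < R₁ ∧ R₁ ≤ R₁⋆ ∧ RawEntryLetters (A′ ↦ toMatrix (G(e^{iηA′}U₀))) (bondReadingY ∘ fst) (R₁·m∕(m + 4B′c_V)) κ (8∕m)` — radius a FIXED FRACTION of the R-station's
radius (versus the thin `R₁∕(4B′(4∕m)c_V′² + 1)`), constant `8∕m` (versus `2(4∕m)` — the same), rate from the same Combes–Thomas window.  Displayed as in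
`exists_rawEntryLetters_toMatrix_GAY_recordV4_prodCfg_ballFamily_of_reg335_of_coercive_located` plus `0 < m` and the window.
[cite: Balaban1985BackgroundPropagators, (3.19)–(3.27) pp.393–395, (3.35) p.396, Thm 3.1 (3.42) p.397, Thm 3.2 (3.48) p.398, Thm 3.3 p.399, Thm 3.4 p.400, (3.84)–(3.86) p.407, Thm 3.10 (3.107)–(3.108) pp.415–416, Thm 3.11 p.416; Balaban1984PropagatorsII, (2.19) and p.226, Lemma 2.1 (2.61) p.234; Balaban1988RG2Cluster, (2.5)–(2.7) pp.12–13, p.15; AizenmanWarzel2015, §10.3] -/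
theorem exists_rawEntryLetters_toMatrix_GAY_recordV4_prodCfg_halfMargin_of_reg335_of_coercive_located
    (hG : G ≤ B7Prop2Explicit.unitaryUnits (Matrix (Fin N) (Fin N) ℂ))
    {U₀ : CfgY (Matrix (Fin N) (Fin N) ℂ) i} {c α₀ : ℝ} (hC0 : 0 ≤ c * (kGeo i).M * α₀) (hC1 : c * (kGeo i).M * α₀ * ((d : ℝ) + 1) ≤ 1 / 16)
    (hreg : (bg9K (Matrix (Fin N) (Fin N) ℂ) G i).Reg335 c α₀ U₀)
    (η : ℝ) {Rc : ℝ} (hRc : 0 < Rc) {ρ' : ℝ} (hρ'0 : 0 ≤ ρ')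
    (hρ' : ρ' < (1 / (4 * ((d : ℝ) + 2))) * ((((d : ℝ) + 1) * ((((ℓ + 1) ^ i.k : ℕ) : ℝ)))⁻¹))
    {μX : ℝ} (hμX : 0 < μX) (hμρ : μX < ρ')
    {κX : ℝ} (hκX : 0 ≤ κX) (hκ4X : κX ≤ (ρ' - μX) / 4)
    (hκmX : 8 * (Real.sqrt ((((ℓ : ℝ) + 1) ^ i.k) ^ (d + 1)) *
        (1 * (Fintype.card (Fin N × Fin N) : ℝ) *
            (1 * ((1 * Real.exp (|η| * Rc)) ^ ((d + 1) * ((ℓ + 1) ^ i.k - 1)) * 1 * (1 * Real.exp (|η| * Rc)) ^ ((d + 1) * ((ℓ + 1) ^ i.k - 1)))) *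
          ((((ℓ : ℝ) + 1) ^ i.k) ^ (d + 1) * (Fintype.card (Fin N × Fin N) : ℝ) *
            (1 * ((1 * Real.exp (|η| * Rc)) ^ ((d + 1) * ((ℓ + 1) ^ i.k - 1)) * 1 * (1 * Real.exp (|η| * Rc)) ^ ((d + 1) * ((ℓ + 1) ^ i.k - 1))))) *
          ((2 * (1 * 1 * (16 * ((((ℓ + 1) ^ i.k : ℕ) : ℝ)) ^ 2 * Real.sqrt N))) * (2 * (1 * 1 * (16 * ((((ℓ + 1) ^ i.k : ℕ) : ℝ)) ^ 2 * Real.sqrt N))) *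
            (((N * N : ℕ) : ℝ) * B6.c0 1 μX ^ (d + 1))) *
          Real.exp (2 * (ρ' - μX) * (((d : ℝ) + 1) * (((((ℓ + 1) ^ i.k : ℕ) : ℝ)) - 1))))) * κX *
        (((N * N : ℕ) : ℝ) * B6.c0 1 ((ρ' - μX) / 2) ^ (d + 1)) ≤
      ((4 * ((d : ℝ) + 1) + 1) ^ 2)⁻¹ * (ρ' - μX))
    {ρ'' : ℝ} (hρ''0 : 0 ≤ ρ'') (hρ'' : ρ'' < κX)
    {μ : ℝ} (hμ : 0 < μ) (h2μ : 2 * μ < ρ'')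
    {B' : ℝ}
    (hBΔ : ∀ R : ℝ, 0 < R → R ≤ Rc →
      1 * (((4 * ((d : ℝ) + 1) * |i.cf|) * ((1 * Real.exp (|η| * R)) * ((1 * Real.exp (|η| * R)) ^ 4 * ((4 * |i.cf|) * ((1 * Real.exp (|η| * R)) * 1 * (1 * Real.exp (|η| * R))))) * (1 * Real.exp (|η| * R))) + 1 / 2 * ((4 * ((d : ℝ) + 1)) * ((1 * Real.exp (|η| * R)) * (2 * (i.cf ^ 2 * (1 * Real.exp (|η| * R)) ^ 4) * (8 * ((1 * Real.exp (|η| * R)) * 1 * (1 * Real.exp (|η| * R))))) * (1 * Real.exp (|η| * R))))) + 2 * ((1 * Real.exp (|η| * R)) ^ ((d + 2) * ((ℓ + 1) ^ i.k - 1)) * ((|b₁| * i.cf ^ 2 * ((((ℓ + 1 : ℕ) : ℝ)) ^ i.k) ^ (d + 1)) * (1 * ((1 * Real.exp (|η| * R)) ^ ((d + 2) * ((ℓ + 1) ^ i.k - 1)) * 1 * (1 * Real.exp (|η| * R)) ^ ((d + 2) * ((ℓ + 1) ^ i.k - 1))))) * (1 * Real.exp (|η| * R)) ^ ((d + 2)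 * ((ℓ + 1) ^ i.k - 1)))) * Real.exp ((ρ'' - 2 * μ) * (2 * (((d : ℝ) + 2) * ((((ℓ + 1) ^ i.k : ℕ) : ℝ) - 1)))) +
          (2 * |i.cf|) * (Fintype.card (Fin N × Fin N) : ℝ) * (1 * ((1 * Real.exp (|η| * R)) * 1 * (1 * Real.exp (|η| * R)))) * ((2 * |i.cf|) * (Fintype.card (Fin N × Fin N) : ℝ) * (1 * ((1 * Real.exp (|η| * R)) * 1 * (1 * Real.exp (|η| * R))))) * (1 + 2 * (1 * 1 * (16 * ((((ℓ + 1) ^ i.k : ℕ) : ℝ)) ^ 2 * Real.sqrt N)) *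
            (1 * (Fintype.card (Fin N × Fin N) : ℝ) *
                (1 * ((1 * Real.exp (|η| * R)) ^ ((d + 1) * ((ℓ + 1) ^ i.k - 1)) * 1 * (1 * Real.exp (|η| * R)) ^ ((d + 1) * ((ℓ + 1) ^ i.k - 1)))) *
              (1 * (Fintype.card (Fin N × Fin N) : ℝ) *
                (1 * ((1 * Real.exp (|η| * R)) ^ ((d + 1) * ((ℓ + 1) ^ i.k - 1)) * 1 * (1 * Real.exp (|η| * R)) ^ ((d + 1) * ((ℓ + 1) ^ i.k - 1))))) *
              (2 * (1 * 1 * ((N : ℝ) ^ 3 * (Real.sqrt ((((ℓ : ℝ) + 1) ^ i.k) ^ (d + 1)) * (4 / ((4 * ((d : ℝ) + 1) + 1) ^ 2)⁻¹))))) *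
              Real.exp (2 * ρ'' * (((d : ℝ) + 1) * ((((ℓ + 1) ^ i.k : ℕ) : ℝ) - 1))) * (2 * (1 * 1 * (16 * ((((ℓ + 1) ^ i.k : ℕ) : ℝ)) ^ 2 * Real.sqrt N))) *
              (((N * N : ℕ) : ℝ) * B6.c0 1 μ ^ (d + 1))) *
            (((N * N : ℕ) : ℝ) * B6.c0 1 μ ^ (d + 1))) * Real.exp (2 * (ρ'' - 2 * μ) * 1) ≤ B')
    {m : ℝ} (hm : 0 < m)
    (hco : ∀ Ψ : FBondY i → Matrix (Fin N) (Fin N) ℂ,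
      m * trIP (fun _ => (1 : ℝ)) Ψ Ψ ≤ trIP (fun _ => (1 : ℝ)) Ψ (deltaAY i (parSymY i) (parBY i) (GpY i (parSymY i)) U₀ Ψ))
    {κ : ℝ} (hκ : 0 ≤ κ) (hκ4 : κ ≤ (ρ'' - 2 * μ) / 4)
    (hκm : 16 * B' * κ * ((((d + 1) * (N * N) : ℕ) : ℝ) * B6.c0 1 ((ρ'' - 2 * μ) / 2) ^ (d + 1)) ≤ m * (ρ'' - 2 * μ)) :
    ∃ R₁ : ℝ, 0 < R₁ ∧ R₁ ≤ Rc / (4 * ((1 * (((d : ℝ) + 1) * (1 * Real.exp (|η| * Rc) * (1 * Real.exp (|η| * Rc) * 1 * (1 * Real.exp (|η| * Rc)) + 1) * (1 * Real.exp (|η| * Rc)) +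
            (1 * Real.exp (|η| * Rc) * 1 * (1 * Real.exp (|η| * Rc)) + 1)) + 1 * ((1 * Real.exp (|η| * Rc)) ^ (2 * (d + 1) * ((ℓ + 1) ^ i.k - 1)) * 1 * (1 * Real.exp (|η| * Rc)) ^ (2 * (d + 1) * ((ℓ + 1) ^ i.k - 1)))) *
            Real.exp ((1 / (4 * ((d : ℝ) + 2)) * ((((d : ℝ) + 1) * ((((ℓ + 1) ^ i.k : ℕ) : ℝ)))⁻¹)) * (((d : ℝ) + 1) * ((((ℓ + 1) ^ i.k : ℕ) : ℝ))))) * (1 * 1 * (16 * ((((ℓ + 1) ^ i.k : ℕ) : ℝ)) ^ 2 * Real.sqrt N)) *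
          (((N * N : ℕ) : ℝ) * B6.c0 1 (((1 / (4 * ((d : ℝ) + 2))) * ((((d : ℝ) + 1) * ((((ℓ + 1) ^ i.k : ℕ) : ℝ)))⁻¹) - ρ') / 3) ^ (d + 1)) *
          (((N * N : ℕ) : ℝ) * B6.c0 1 (((1 / (4 * ((d : ℝ) + 2))) * ((((d : ℝ) + 1) * ((((ℓ + 1) ^ i.k : ℕ) : ℝ)))⁻¹) - ρ') / 3) ^ (d + 1))) + 1) ∧
  RawEntryLetters (fun a : Fin (d + 1) → Site (PV d ℓ i.m i.K hd hL) 0 → Matrix (Fin N) (Fin N) ℂ => LinearMap.toMatrix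
          ((Pi.basis fun _ : FBondY i => Matrix.stdBasis ℂ (Fin N) (Fin N)).reindex (Equiv.sigmaEquivProd (FBondY i) (Fin N × Fin N))) ((Pi.basis fun _ : FBondY i => Matrix.stdBasis ℂ (Fin N) (Fin N)).reindex (Equiv.sigmaEquivProd (FBondY i) (Fin N × Fin N)))
          (GAY i (parSymY i) (parBY i) (GpY i (parSymY i)) (prodCfg U₀ η a))) (fun p : FBondY i × (Fin N × Fin N) => bondReadingY i i.hN p.1)
      (R₁ * (m / (m + 4 * (B' * ((((d + 1) * (N * N) : ℕ) : ℝ) * B6.c0 1 (ρ'' - 2 * μ) ^ (d + 1)))))) κ (8 / m) := by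
  -- R along the pencil on (3.35) at the fine reading, `hXi` discharged (dag-n10-w2 g4 ∘ dag-n10-w5), at some radius `0 < R₁ ≤ R₁⋆`
  obtain ⟨R₁, hR₁, hR₁le, hR⟩ :=
    B13OpsYPencilRProjSymLocated.rawEntryLetters_toMatrix_RY_parSymY_prodCfg_of_reg335_located_of_xinvLocated i hG hC0 hC1 hreg η hRc hρ'0 hρ' hμX hμρ hκX
      hκ4X hκmX hρ''0 hρ'' hμ h2μ.le
  -- `R₁⋆ ≤ Rc`: the thin radius divides `Rc` by `4T + 1 ≥ 1`
  have hT : 0 ≤ ((1 * (((d : ℝ) + 1) *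
          (1 * Real.exp (|η| * Rc) * (1 * Real.exp (|η| * Rc) * 1 * (1 * Real.exp (|η| * Rc)) + 1) * (1 * Real.exp (|η| * Rc)) +
            (1 * Real.exp (|η| * Rc) * 1 * (1 * Real.exp (|η| * Rc)) + 1)) +
          1 * ((1 * Real.exp (|η| * Rc)) ^ (2 * (d + 1) * ((ℓ + 1) ^ i.k - 1)) * 1 * (1 * Real.exp (|η| * Rc)) ^ (2 * (d + 1) * ((ℓ + 1) ^ i.k - 1)))) *
            Real.exp ((1 / (4 * ((d : ℝ) + 2)) * ((((d : ℝ) + 1) * ((((ℓ + 1) ^ i.k : ℕ) : ℝ)))⁻¹)) * (((d : ℝ) + 1) * ((((ℓ + 1) ^ i.k : ℕ) : ℝ))))) *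
          (1 * 1 * (16 * ((((ℓ + 1) ^ i.k : ℕ) : ℝ)) ^ 2 * Real.sqrt N)) *
          (((N * N : ℕ) : ℝ) * B6.c0 1 (((1 / (4 * ((d : ℝ) + 2))) * ((((d : ℝ) + 1) * ((((ℓ + 1) ^ i.k : ℕ) : ℝ)))⁻¹) - ρ') / 3) ^ (d + 1)) *
          (((N * N : ℕ) : ℝ) * B6.c0 1 (((1 / (4 * ((d : ℝ) + 2))) * ((((d : ℝ) + 1) * ((((ℓ + 1) ^ i.k : ℕ) : ℝ)))⁻¹) - ρ') / 3) ^ (d + 1))) :=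
    mul_nonneg (mul_nonneg (mul_nonneg
      (mul_nonneg (mul_nonneg zero_le_one (add_nonneg (by positivity) (mul_nonneg zero_le_one (by positivity)))) (Real.exp_pos _).le)
      (by positivity)) (mul_nonneg (Nat.cast_nonneg _) (pow_nonneg (B6RandomWalk.c0_nonneg 1 _) _)))
      (mul_nonneg (Nat.cast_nonneg _) (pow_nonneg (B6RandomWalk.c0_nonneg 1 _) _))
  have hR₁Rc : R₁ ≤ Rc := hR₁le.trans (div_le_self hRc.le (by linarith))
  have hρR : 0 < ρ'' - 2 * μ := by linarith
  -- Δ_a's letters at the record (for `0 ≤ B′`) and the numeral `c_V ≥ 0`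
  have hA := rawEntryLetters_toMatrix_deltaAY_parBY_prodCfg_of_pencil_located i (parSymY i) (GpY i (parSymY i)) hG hreg.1 i.hN η hR₁.le hρR.le hR
  have hB'0 : 0 ≤ B' := hA.B_nonneg.trans (hBΔ R₁ hR₁ hR₁Rc)
  set cV : ℝ := ((((d + 1) * (N * N) : ℕ) : ℝ) * B6.c0 1 (ρ'' - 2 * μ) ^ (d + 1)) with hcV
  have hcV0 : 0 ≤ cV := mul_nonneg (Nat.cast_nonneg _) (pow_nonneg (B6RandomWalk.c0_nonneg 1 _) _)
  have hc : 0 ≤ B' * cV := mul_nonneg hB'0 hcV0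
  have hden : 0 < m + 4 * (B' * cV) := by positivity
  have hq0 : 0 ≤ m / (m + 4 * (B' * cV)) := div_nonneg hm.le hden.le
  have hq1 : m / (m + 4 * (B' * cV)) ≤ 1 := by rw [div_le_one hden]; linarith
  have hR'0 : 0 ≤ R₁ * (m / (m + 4 * (B' * cV))) := mul_nonneg hR₁.le hq0
  have hR'R : R₁ * (m / (m + 4 * (B' * cV))) ≤ R₁ := mul_le_of_le_one_right hR₁.le hq1
  -- the margin at the half-margin radius is `≥ m∕2`
  have hkey : 2 * (B' * cV) * (R₁ * (m / (m + 4 * (B' * cV)))) / R₁ = 2 * (B' * cV) * m / (m + 4 * (B' * cV)) := by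
    field_simp
  have hm' : m / 2 ≤ m - 2 * (B' * cV) * (R₁ * (m / (m + 4 * (B' * cV)))) / R₁ := by
    rw [hkey]
    have h1 : 2 * (B' * cV) * m / (m + 4 * (B' * cV)) ≤ m / 2 := by
      rw [div_le_iff₀ hden]
      nlinarith [sq_nonneg m, hc, hm.le]
    linarith
  have hmarg : 0 < m - 2 * (B' * cV) * (R₁ * (m / (m + 4 * (B' * cV)))) / R₁ := lt_of_lt_of_le (half_pos hm) hm'
  -- the displayed window implies module 84's window at margin `m′ ≥ m∕2`
  have hκm' : 8 * B' * κ * ((((d + 1) * (N * N) : ℕ) : ℝ) * B6.c0 1 ((ρ'' - 2 * μ) / 2) ^ (d + 1)) ≤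
      (m - 2 * (B' * cV) * (R₁ * (m / (m + 4 * (B' * cV)))) / R₁) * (ρ'' - 2 * μ) :=
    calc 8 * B' * κ * ((((d + 1) * (N * N) : ℕ) : ℝ) * B6.c0 1 ((ρ'' - 2 * μ) / 2) ^ (d + 1))
        = (16 * B' * κ * ((((d + 1) * (N * N) : ℕ) : ℝ) * B6.c0 1 ((ρ'' - 2 * μ) / 2) ^ (d + 1))) / 2 := by ring
      _ ≤ (m * (ρ'' - 2 * μ)) / 2 := by gcongr
      _ = (m / 2) * (ρ'' - 2 * μ) := by ring
      _ ≤ _ := mul_le_mul_of_nonneg_right hm' hρR.le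
  have h := rawEntryLetters_toMatrix_GAY_parBY_prodCfg_ball_of_pencil_of_coercive_located i (parSymY i) (GpY i (parSymY i)) hG hreg.1 i.hN η hR₁.le hρR hR
    (hBΔ R₁ hR₁ hR₁Rc) hco hR'0 hR'R hmarg hκ hκ4 hκm'
  -- constant `4∕m′ ≤ 8∕m`
  have h48 : 4 / (m - 2 * (B' * cV) * (R₁ * (m / (m + 4 * (B' * cV)))) / R₁) ≤ 8 / m := by
    rw [div_le_div_iff₀ hmarg hm]
    linarith
  exact ⟨R₁, hR₁, hR₁le, rawEntryLetters_mono h le_rfl le_rfl h48⟩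

/-- ★★★★ **… AT THE HALF-MARGIN RADIUS WITH THE CENTRE FROM PRINT's TWO STATEMENTS** (`m = B⁻¹` by module 82 §2 from Theorem 3.11's clause `PosDefTr 1 (Δ_a(U₀))`
and Theorem 3.3's (3.46)–(3.47) form bound `⟨Φ, G(U₀)Φ⟩₁ ≤ B⟨Φ,Φ⟩₁`, `0 < B`): displayed as in
`exists_rawEntryLetters_toMatrix_GAY_recordV4_prodCfg_halfMargin_of_reg335_of_coercive_located` with `(hm, hco)` replaced by `(hpd, hB, hGB)` and the window
`16B′κ((d+1)N²c₀(1,(ρ″−2μ)∕2)^{d+1}) ≤ B⁻¹(ρ″−2μ)`; conclusion `∃ R₁, 0 < R₁ ∧ R₁ ≤ R₁⋆ ∧ RawEntryLetters (A′ ↦ toMatrix (G(e^{iηA′}U₀))) (bondReadingY ∘ fst)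
(R₁·B⁻¹∕(B⁻¹ + 4B′c_V)) κ (8B)`.
[cite: Balaban1985BackgroundPropagators, (3.19)–(3.27) pp.393–395, (3.35) p.396, Thm 3.1 (3.42) p.397, Thm 3.2 (3.48) p.398, (3.46)–(3.47) p.398, Thm 3.3 p.399, Thm 3.4 p.400, (3.84)–(3.86) p.407, Thm 3.10 (3.107)–(3.108) pp.415–416, Thm 3.11 p.416; Balaban1984PropagatorsII, (2.19) and p.226, Lemma 2.1 (2.61) p.234; Balaban1988RG2Cluster, (2.5)–(2.7) pp.12–13, p.15; AizenmanWarzel2015, §10.3] -/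
theorem exists_rawEntryLetters_toMatrix_GAY_recordV4_prodCfg_halfMargin_of_reg335_of_posDefTr_of_formBound_located
    (hG : G ≤ B7Prop2Explicit.unitaryUnits (Matrix (Fin N) (Fin N) ℂ))
    {U₀ : CfgY (Matrix (Fin N) (Fin N) ℂ) i} {c α₀ : ℝ} (hC0 : 0 ≤ c * (kGeo i).M * α₀) (hC1 : c * (kGeo i).M * α₀ * ((d : ℝ) + 1) ≤ 1 / 16)
    (hreg : (bg9K (Matrix (Fin N) (Fin N) ℂ) G i).Reg335 c α₀ U₀)
    (η : ℝ) {Rc : ℝ} (hRc : 0 < Rc) {ρ' : ℝ} (hρ'0 : 0 ≤ ρ')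
    (hρ' : ρ' < (1 / (4 * ((d : ℝ) + 2))) * ((((d : ℝ) + 1) * ((((ℓ + 1) ^ i.k : ℕ) : ℝ)))⁻¹))
    {μX : ℝ} (hμX : 0 < μX) (hμρ : μX < ρ')
    {κX : ℝ} (hκX : 0 ≤ κX) (hκ4X : κX ≤ (ρ' - μX) / 4)
    (hκmX : 8 * (Real.sqrt ((((ℓ : ℝ) + 1) ^ i.k) ^ (d + 1)) *
        (1 * (Fintype.card (Fin N × Fin N) : ℝ) *
            (1 * ((1 * Real.exp (|η| * Rc)) ^ ((d + 1) * ((ℓ + 1) ^ i.k - 1)) * 1 * (1 * Real.exp (|η| * Rc)) ^ ((d + 1) * ((ℓ + 1) ^ i.k - 1)))) *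
          ((((ℓ : ℝ) + 1) ^ i.k) ^ (d + 1) * (Fintype.card (Fin N × Fin N) : ℝ) *
            (1 * ((1 * Real.exp (|η| * Rc)) ^ ((d + 1) * ((ℓ + 1) ^ i.k - 1)) * 1 * (1 * Real.exp (|η| * Rc)) ^ ((d + 1) * ((ℓ + 1) ^ i.k - 1))))) *
          ((2 * (1 * 1 * (16 * ((((ℓ + 1) ^ i.k : ℕ) : ℝ)) ^ 2 * Real.sqrt N))) * (2 * (1 * 1 * (16 * ((((ℓ + 1) ^ i.k : ℕ) : ℝ)) ^ 2 * Real.sqrt N))) *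
            (((N * N : ℕ) : ℝ) * B6.c0 1 μX ^ (d + 1))) *
          Real.exp (2 * (ρ' - μX) * (((d : ℝ) + 1) * (((((ℓ + 1) ^ i.k : ℕ) : ℝ)) - 1))))) * κX *
        (((N * N : ℕ) : ℝ) * B6.c0 1 ((ρ' - μX) / 2) ^ (d + 1)) ≤
      ((4 * ((d : ℝ) + 1) + 1) ^ 2)⁻¹ * (ρ' - μX))
    {ρ'' : ℝ} (hρ''0 : 0 ≤ ρ'') (hρ'' : ρ'' < κX)
    {μ : ℝ} (hμ : 0 < μ) (h2μ : 2 * μ < ρ'')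
    {B' : ℝ}
    (hBΔ : ∀ R : ℝ, 0 < R → R ≤ Rc →
      1 * (((4 * ((d : ℝ) + 1) * |i.cf|) * ((1 * Real.exp (|η| * R)) * ((1 * Real.exp (|η| * R)) ^ 4 * ((4 * |i.cf|) * ((1 * Real.exp (|η| * R)) * 1 * (1 * Real.exp (|η| * R))))) * (1 * Real.exp (|η| * R))) + 1 / 2 * ((4 * ((d : ℝ) + 1)) * ((1 * Real.exp (|η| * R)) * (2 * (i.cf ^ 2 * (1 * Real.exp (|η| * R)) ^ 4) * (8 * ((1 * Real.exp (|η| * R)) * 1 * (1 * Real.exp (|η| * R))))) * (1 * Real.exp (|η| * R))))) + 2 * ((1 * Real.exp (|η| * R)) ^ ((d + 2) * ((ℓ + 1) ^ i.k - 1)) * ((|b₁| * i.cf ^ 2 * ((((ℓ + 1 : ℕ) : ℝ)) ^ i.k) ^ (d + 1)) * (1 * ((1 * Real.exp (|η| * R)) ^ ((d + 2) * ((ℓ + 1) ^ i.k - 1)) * 1 * (1 * Real.exp (|η| * R)) ^ ((d + 2) * ((ℓ + 1) ^ i.k - 1))))) * (1 * Real.exp (|η| * R)) ^ ((d + 2)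 * ((ℓ + 1) ^ i.k - 1)))) * Real.exp ((ρ'' - 2 * μ) * (2 * (((d : ℝ) + 2) * ((((ℓ + 1) ^ i.k : ℕ) : ℝ) - 1)))) +
          (2 * |i.cf|) * (Fintype.card (Fin N × Fin N) : ℝ) * (1 * ((1 * Real.exp (|η| * R)) * 1 * (1 * Real.exp (|η| * R)))) * ((2 * |i.cf|) * (Fintype.card (Fin N × Fin N) : ℝ) * (1 * ((1 * Real.exp (|η| * R)) * 1 * (1 * Real.exp (|η| * R))))) * (1 + 2 * (1 * 1 * (16 * ((((ℓ + 1) ^ i.k : ℕ) : ℝ)) ^ 2 * Real.sqrt N)) *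
            (1 * (Fintype.card (Fin N × Fin N) : ℝ) *
                (1 * ((1 * Real.exp (|η| * R)) ^ ((d + 1) * ((ℓ + 1) ^ i.k - 1)) * 1 * (1 * Real.exp (|η| * R)) ^ ((d + 1) * ((ℓ + 1) ^ i.k - 1)))) *
              (1 * (Fintype.card (Fin N × Fin N) : ℝ) *
                (1 * ((1 * Real.exp (|η| * R)) ^ ((d + 1) * ((ℓ + 1) ^ i.k - 1)) * 1 * (1 * Real.exp (|η| * R)) ^ ((d + 1) * ((ℓ + 1) ^ i.k - 1))))) *
              (2 * (1 * 1 * ((N : ℝ) ^ 3 * (Real.sqrt ((((ℓ : ℝ) + 1) ^ i.k) ^ (d + 1)) * (4 / ((4 * ((d : ℝ) + 1) + 1) ^ 2)⁻¹))))) *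
              Real.exp (2 * ρ'' * (((d : ℝ) + 1) * ((((ℓ + 1) ^ i.k : ℕ) : ℝ) - 1))) * (2 * (1 * 1 * (16 * ((((ℓ + 1) ^ i.k : ℕ) : ℝ)) ^ 2 * Real.sqrt N))) *
              (((N * N : ℕ) : ℝ) * B6.c0 1 μ ^ (d + 1))) *
            (((N * N : ℕ) : ℝ) * B6.c0 1 μ ^ (d + 1))) * Real.exp (2 * (ρ'' - 2 * μ) * 1) ≤ B')
    -- print's two statements at the centre: Theorem 3.11's clause (row 17) and Theorem 3.3's (3.46)–(3.47) for `G`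
    (hpd : PosDefTr (fun _ => (1 : ℝ)) (deltaAY i (parSymY i) (parBY i) (GpY i (parSymY i)) U₀))
    {B : ℝ} (hB : 0 < B)
    (hGB : ∀ Φ : FBondY i → Matrix (Fin N) (Fin N) ℂ,
      trIP (fun _ => (1 : ℝ)) Φ (GAY i (parSymY i) (parBY i) (GpY i (parSymY i)) U₀ Φ) ≤ B * trIP (fun _ => (1 : ℝ)) Φ Φ)
    {κ : ℝ} (hκ : 0 ≤ κ) (hκ4 : κ ≤ (ρ'' - 2 * μ) / 4)
    (hκm : 16 * B' * κ * ((((d + 1) * (N * N) : ℕ) : ℝ) * B6.c0 1 ((ρ'' - 2 * μ) / 2) ^ (d + 1)) ≤ B⁻¹ * (ρ'' - 2 * μ)) :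
    ∃ R₁ : ℝ, 0 < R₁ ∧ R₁ ≤ Rc / (4 * ((1 * (((d : ℝ) + 1) * (1 * Real.exp (|η| * Rc) * (1 * Real.exp (|η| * Rc) * 1 * (1 * Real.exp (|η| * Rc)) + 1) * (1 * Real.exp (|η| * Rc)) +
            (1 * Real.exp (|η| * Rc) * 1 * (1 * Real.exp (|η| * Rc)) + 1)) + 1 * ((1 * Real.exp (|η| * Rc)) ^ (2 * (d + 1) * ((ℓ + 1) ^ i.k - 1)) * 1 * (1 * Real.exp (|η| * Rc)) ^ (2 * (d + 1) * ((ℓ + 1) ^ i.k - 1)))) *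
            Real.exp ((1 / (4 * ((d : ℝ) + 2)) * ((((d : ℝ) + 1) * ((((ℓ + 1) ^ i.k : ℕ) : ℝ)))⁻¹)) * (((d : ℝ) + 1) * ((((ℓ + 1) ^ i.k : ℕ) : ℝ))))) * (1 * 1 * (16 * ((((ℓ + 1) ^ i.k : ℕ) : ℝ)) ^ 2 * Real.sqrt N)) *
          (((N * N : ℕ) : ℝ) * B6.c0 1 (((1 / (4 * ((d : ℝ) + 2))) * ((((d : ℝ) + 1) * ((((ℓ + 1) ^ i.k : ℕ) : ℝ)))⁻¹) - ρ') / 3) ^ (d + 1)) *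
          (((N * N : ℕ) : ℝ) * B6.c0 1 (((1 / (4 * ((d : ℝ) + 2))) * ((((d : ℝ) + 1) * ((((ℓ + 1) ^ i.k : ℕ) : ℝ)))⁻¹) - ρ') / 3) ^ (d + 1))) + 1) ∧
  RawEntryLetters (fun a : Fin (d + 1) → Site (PV d ℓ i.m i.K hd hL) 0 → Matrix (Fin N) (Fin N) ℂ => LinearMap.toMatrix
          ((Pi.basis fun _ : FBondY i => Matrix.stdBasis ℂ (Fin N) (Fin N)).reindex (Equiv.sigmaEquivProd (FBondY i) (Fin N × Fin N))) ((Pi.basis fun _ : FBondY i => Matrix.stdBasis ℂ (Fin N) (Fin N)).reindex (Equiv.sigmaEquivProd (FBondY i) (Fin N × Fin N)))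
          (GAY i (parSymY i) (parBY i) (GpY i (parSymY i)) (prodCfg U₀ η a))) (fun p : FBondY i × (Fin N × Fin N) => bondReadingY i i.hN p.1)
      (R₁ * (B⁻¹ / (B⁻¹ + 4 * (B' * ((((d + 1) * (N * N) : ℕ) : ℝ) * B6.c0 1 (ρ'' - 2 * μ) ^ (d + 1)))))) κ (8 * B) := by
  obtain ⟨R₁, hR₁, hR₁le, h⟩ := exists_rawEntryLetters_toMatrix_GAY_recordV4_prodCfg_halfMargin_of_reg335_of_coercive_located i hG hC0 hC1 hreg η hRc hρ'0 hρ'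
    hμX hμρ hκX hκ4X hκmX hρ''0 hρ'' hμ h2μ hBΔ (inv_pos.mpr hB) (trIP_deltaAY_parSymY_ge_of_posDefTr_of_GAY_formBound i hG hreg.1 hpd hB hGB) hκ hκ4 hκm
  exact ⟨R₁, hR₁, hR₁le, by simpa only [div_inv_eq_mul] using h⟩

end Literature.MathematicalPhysics.QuantumFieldTheory.Balaban1983to89.B13GreenChainOnCoerciveBallReg335Located

end
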